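import Mathlib
import Summits.ValiantsHypothesis.ValiantsHypothesis.Theorems.BarrierLeverSuccinctHittingSetsForVPSeparableCoeffFast
import Summits.ValiantsHypothesis.ValiantsHypothesis.Theorems.BarrierLeverSuccinctHittingSetsForVPStubReadOnceHit
import HarnessLib

/-!
# The succinct Shpilka–Volkovich generator at exponent 4: read-once distinguishers, products of
sparse distinguishers, and the level-one reduction (crux stmt-ValiantsHypothesis-14610 side;
docket 8745/8749 of seat val-np-p5)

**What is proved (unconditional; it does NOT close any item).** The tree's generator rows
`readOnceHit_five` / `not_isNaturalProof_prop_five` (preprocessed read-once formulas, `4n` seeds),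
`exists_sparseGenerator_five` / `isSuccinctHittingSet_sparseProducts_five` /
`not_isNaturalProof_prod_sparse_five` (products of `N^a`-sparse polynomials, `2an` seeds) and
`levelOne_of_generator_annihilators_five` (level one reduces to the annihilators of the generator,
`max 5 b`) realise each seed polynomial `Λ_j` (`coeff_μ Λ_j = ∏_i ℓ_{μ_i}(z_{j,i})`, an ARBITRARY
separable table since `ℓ_0(z) = 0` for `z ∈ {1, …, n}`) by `SeparableCoeffThree.separableCoeff_three`
at size `n³`, whence exponent `5`. With `SeparableCoeffFast.separableCoeff_fast'` (size `≤ 5n²`,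
`n ≥ 8192`, the Newton/FFT engine of `SeparableSeriesCircuit.lean` behind the zero-handling
reduction) the SAME proofs give exponent `4`:
budgets `n³ + (4n(5n² + 1) + 4n) + 1 ≤ n⁴` (`n ≥ 22`) and `n³ + (2an(5n² + 1) + 2an) + 1 ≤ n⁴`
(`n ≥ max 3 (10a + 2)`), glue `add_sum_mem_smallCircuits_of_le` (the tree's
`GeneratorGlue.add_sum_mem_smallCircuits` with an explicit seed size in place of `n^{b₁}`).

* `readOnceHit_four`, `not_isNaturalProof_prop_four` (row 'read-once / PROP distinguishers': 5 → 4);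
* `exists_sparseGenerator_four`, `isSuccinctHittingSet_sparseProducts_four`,
  `not_isNaturalProof_prod_sparse_four` (row 'products of sparse distinguishers': 5 → 4);
* `levelOne_of_generator_annihilators_four` (row 'level-one reduction': `max 5 b` → `max 4 b`).

Why not lower: the generator needs `t ≥ log₂ C(2n,n) ≥ 2n - O(log n)` seeds, and each seed's
`W`-series alone costs `≈ n 2^J ≈ 2n²` gates even with shared powers, so `≈ 4n³ > n³` in total;
exponent `3` for these rows needs a different generator, exponent `2` a different idea.

Honest framing: 14610-side bookkeeping (chart rows at the rank-method census); the 8749-side doors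
stay as they are; nothing here bears on the open cruxes 8745/8749 (open at `b = 2`,
Chatterjee–Tengse §1.3) or on `VP ≠ VNP`.

References: [ForbesShpilkaVolk2018] §3, Construction 25/29, Cor. 34, Question 6;
[ShpilkaVolkovich2015] Thm. 1; [MinahanVolkovich2017] Def. 12.
-/

-- layout Summits/ValiantsHypothesis/ValiantsHypothesis forces the duplicated namespace component
set_option linter.dupNamespace false

noncomputable section

namespace Summit.ValiantsHypothesis.ValiantsHypothesis.Theorems.BarrierLever.SuccinctHittingSetsForVP

open Literature.Barriers.ValiantsHypothesis Literature.Computability.AlgebraicComplexity MvPolynomial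

namespace GeneratorFour

variable {n : ℕ}

/-- **Realisability of the generator with an explicit seed size.** If `f₀ ∈ SmallCircuits ℂ n b₀`,
every `Λ_j` (`j < t`) has degree `≤ n` and size `≤ s`, and `n^b₀ + (t(s + 1) + t) + 1 ≤ n^b`, then
`f₀ + Σ_j c_j Λ_j ∈ SmallCircuits ℂ n b` (tree: `GeneratorGlue.add_sum_mem_smallCircuits`, seeds in
`SmallCircuits ℂ n b₁`). [cite: ForbesShpilkaVolk2018, Construction 29] -/
theorem add_sum_mem_smallCircuits_of_le {b₀ b t s : ℕ}
    (h : n ^ b₀ + (t * (s + 1) + t) + 1 ≤ n ^ b)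
    {f₀ : MvPolynomial (Fin n) ℂ} (hf₀ : f₀ ∈ SmallCircuits ℂ n b₀)
    {Λ : Fin t → MvPolynomial (Fin n) ℂ} (hΛ : ∀ j, (Λ j).totalDegree ≤ n ∧ complexity (Λ j) ≤ s)
    (c : Fin t → ℂ) :
    f₀ + ∑ j : Fin t, C (c j) * Λ j ∈ SmallCircuits ℂ n b := by
  -- adapted from the tree's `GeneratorGlue.add_sum_mem_smallCircuits`
  refine ⟨(totalDegree_add _ _).trans (max_le hf₀.1 (totalDegree_finsetSum_le fun j _ => ?_)), ?_⟩
  · calc (C (c j) * Λ j).totalDegree ≤ (C (c j) : MvPolynomial (Fin n) ℂ).totalDegree +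
          (Λ j).totalDegree := totalDegree_mul _ _
      _ ≤ n := by rw [totalDegree_C, zero_add]; exact (hΛ j).1
  · calc complexity (f₀ + ∑ j : Fin t, C (c j) * Λ j)
        ≤ complexity f₀ + complexity (∑ j : Fin t, C (c j) * Λ j) + 1 := complexity_add_le_holds _ _
      _ ≤ n ^ b₀ + (∑ j : Fin t, complexity (C (c j) * Λ j) +
            (Finset.univ : Finset (Fin t)).card) + 1 := by
          gcongr
          · exact hf₀.2
          · exact complexity_finset_sum_le _ _
      _ ≤ n ^ b₀ + (∑ _j : Fin t, (s + 1) + t) + 1 := by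
          gcongr with j _
          · calc complexity (C (c j) * Λ j)
                ≤ complexity (C (c j) : MvPolynomial (Fin n) ℂ) + complexity (Λ j) + 1 :=
                  complexity_mul_le_holds _ _
              _ ≤ 0 + s + 1 := by
                  rw [complexity_C_holds]
                  gcongr
                  exact (hΛ j).2
              _ = s + 1 := by ring
          · rw [Finset.card_univ, Fintype.card_fin]
      _ = n ^ b₀ + (t * (s + 1) + t) + 1 := by
          rw [Finset.sum_const, Finset.card_univ, Fintype.card_fin, smul_eq_mul]
      _ ≤ n ^ b := h

/-- The read-once budget at seed size `5n²`: for `n ≥ 22`, `n³ + (4n(5n² + 1) + 4n) + 1 ≤ n⁴`.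
[folklore] -/
theorem size_budget_readOnce (hn : 22 ≤ n) :
    n ^ 3 + (2 * 2 * n * (5 * n ^ 2 + 1) + 2 * 2 * n) + 1 ≤ n ^ 4 := by
  obtain ⟨m, rfl⟩ : ∃ m, n = m + 22 := ⟨n - 22, by omega⟩
  ring_nf
  nlinarith [sq_nonneg m, Nat.zero_le m, Nat.zero_le (m * m), Nat.zero_le (m * m * m)]

/-- The sparse-products budget at seed size `5n²`: for `n ≥ 10a + 2` and `n ≥ 3`,
`n³ + (2an(5n² + 1) + 2an) + 1 ≤ n⁴`. [folklore] -/
theorem size_budget_sparse {a : ℕ} (ha : 10 * a + 2 ≤ n) (hn : 3 ≤ n) :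
    n ^ 3 + (2 * a * n * (5 * n ^ 2 + 1) + 2 * a * n) + 1 ≤ n ^ 4 := by
  have h1 : 2 * a * n * (5 * n ^ 2 + 1) + 2 * a * n = 10 * a * n ^ 3 + 4 * a * n := by ring
  have h2 : 4 * a * n ≤ 2 * n * n := by nlinarith
  have h3 : n ^ 3 + 2 * n * n + 1 ≤ 2 * n ^ 3 := by
    obtain ⟨m, rfl⟩ : ∃ m, n = m + 3 := ⟨n - 3, by omega⟩
    ring_nf
    nlinarith [Nat.zero_le m, Nat.zero_le (m * m), Nat.zero_le (m * m * m)]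
  calc n ^ 3 + (2 * a * n * (5 * n ^ 2 + 1) + 2 * a * n) + 1
      = 10 * a * n ^ 3 + (n ^ 3 + 4 * a * n + 1) := by rw [h1]; ring
    _ ≤ 10 * a * n ^ 3 + 2 * n ^ 3 := by omega
    _ = (10 * a + 2) * n ^ 3 := by ring
    _ ≤ n * n ^ 3 := Nat.mul_le_mul_right _ ha
    _ = n ^ 4 := by ring

end GeneratorFour

/-! ### Read-once (PROP) distinguishers at exponent 4 -/

/-- **Read-once (PROP) distinguishers are hit by `SmallCircuits ℂ n 4`** (tree: `readOnceHit_five`,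
`stub_readOnceHit` at `10`): for all `n ≥ 8192`, the coefficient vectors of `SmallCircuits ℂ n 4` hit
every nonzero polynomial in the `N = C(2n,n)` coefficient variables computed by a preprocessed
read-once formula (`IsPROP`; any size, any degree). Verbatim the tree's proof (succinct
Shpilka–Volkovich generator with `4n` seeds), the seed polynomials realised at size `5n²` by
`SeparableCoeffFast.separableCoeff_fast'`. [cite: ForbesShpilkaVolk2018, §3 and Construction 29]
[cite: ShpilkaVolkovich2015, Thm. 1] -/
theorem readOnceHit_four :
    ∃ n₀ : ℕ, ∀ n : ℕ, n₀ ≤ n → IsSuccinctHittingSet (degLEMonomials n) (SmallCircuits ℂ n 4)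
      {D | ∃ S : Finset (degLEMonomials n), IsPROP S D} := by
  -- adapted from the tree's `readOnceHit_five` / `stub_readOnceHit`
  refine ⟨8192, fun n hn D hD hD0 => ?_⟩
  obtain ⟨S, hS⟩ := hD
  obtain ⟨ℓ, hℓ⟩ := stub_lagrangeIndicator n
  obtain ⟨f₀, hf₀, -⟩ := stub_fullSupport n (by omega)
  haveI : Fintype (degLEMonomials n) := (GKSS2017.degLEMonomials_finite n).fintype
  have hcard : Fintype.card (degLEMonomials n) < 2 ^ (2 * 2 * n) := by
    rw [← Nat.card_eq_fintype_card, GKSS2017.card_degLEMonomials]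
    calc (2 * n).choose n ≤ 2 ^ (2 * n) := Nat.choose_le_two_pow _ _
      _ < 2 ^ (2 * 2 * n) := Nat.pow_lt_pow_right (by norm_num) (by omega)
  have hgen := stub_readOnceGenerator (degLEMonomials n) (Fin n) (2 * 2 * n)
    (fun μ => ∏ i : Fin n, Polynomial.aeval (X i : MvPolynomial (Fin n) ℂ) (ℓ ((μ : Fin n →₀ ℕ) i)))
    (fun ν i => (((ν : Fin n →₀ ℕ) i : ℕ) : ℂ)) (GeneratorGlue.eval_indicator hℓ) hcard
    (fun μ => coeff (μ : Fin n →₀ ℕ) f₀) D S hS hD0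
  refine Generator.exists_mem_smallCircuits_of_aeval_ne_zero (fun p => ?_) hgen
  choose Λ hΛmem hΛcoeff using fun j : Fin (2 * 2 * n) =>
    SeparableCoeffFast.separableCoeff_fast' (n := n) (by omega)
      (fun i k => (ℓ k).eval (p (Sum.inr (j, i))))
  refine ⟨f₀ + ∑ j : Fin (2 * 2 * n), C (p (Sum.inl j)) * Λ j,
    GeneratorFour.add_sum_mem_smallCircuits_of_le (GeneratorFour.size_budget_readOnce (by omega))
      hf₀ hΛmem _, fun μ => ?_⟩
  rw [GeneratorGlue.coeff_add_sum, GeneratorGlue.eval_generator]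
  simp only [GeneratorGlue.eval_prod_aeval, hΛcoeff]

/-- **No read-once-formula natural proof against `SmallCircuits ℂ n b`, `b ≥ 4`** (`n ≥ 8192`).
[cite: ForbesShpilkaVolk2018, Thm. 4] -/
theorem not_isNaturalProof_prop_four :
    ∃ n₀ : ℕ, ∀ n : ℕ, n₀ ≤ n → ∀ b : ℕ, 4 ≤ b →
      ∀ (𝒟 : Set (MvPolynomial (degLEMonomials n) ℂ)) (D : MvPolynomial (degLEMonomials n) ℂ)
        (S : Finset (degLEMonomials n)), IsPROP S D →
        ¬ IsNaturalProof (degLEMonomials n) (SmallCircuits ℂ n b) 𝒟 D := by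
  obtain ⟨n₀, h⟩ := readOnceHit_four
  refine ⟨max n₀ 1, fun n hn b hb 𝒟 D S hS hnat => ?_⟩
  obtain ⟨-, hD0, hvan⟩ := hnat
  obtain ⟨f, hf, hne⟩ := h n (le_of_max_le_left hn) D ⟨S, hS⟩ hD0
  exact hne (hvan f (smallCircuits_mono ℂ hb (le_of_max_le_right hn) hf))

/-! ### Products of sparse distinguishers at exponent 4 -/

open Generator

/-- **The shifted succinct SV generator at exponent 4.** For every `a` there is `n₀`
(`= max 8192 (10a+2)`) such that for all `n ≥ n₀` the generator
`Γ_μ = coeff_μ f₀ + Σ_{j < 2an} W_j ∏_i ℓ_{μ_i}(Z_{j,i})` takes ALL its values in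
`coeff(SmallCircuits ℂ n 4)` and is annihilated by NO nonzero polynomial with at most `C(2n,n)^a`
monomials (tree: `exists_sparseGenerator_five`, and `exists_sparseGenerator` at `10`).
[cite: ForbesShpilkaVolk2018, Construction 29 and Cor. 34] -/
theorem exists_sparseGenerator_four :
    ∀ a : ℕ, ∃ n₀ : ℕ, ∀ n : ℕ, n₀ ≤ n →
      ∃ (t : ℕ) (Γ : degLEMonomials n → MvPolynomial (Fin t ⊕ (Fin t × Fin n)) ℂ),
        (∀ p : Fin t ⊕ (Fin t × Fin n) → ℂ, ∃ f ∈ SmallCircuits ℂ n 4,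
            ∀ μ : degLEMonomials n,
              MvPolynomial.coeff (μ : Fin n →₀ ℕ) f = MvPolynomial.eval p (Γ μ)) ∧
        ∀ D : MvPolynomial (degLEMonomials n) ℂ, D ≠ 0 →
          D.support.card ≤ Nat.choose (2 * n) n ^ a → MvPolynomial.aeval Γ D ≠ 0 := by
  -- adapted from the tree's `exists_sparseGenerator_five` / `stub_generatorGlue`
  intro a
  refine ⟨max 8192 (10 * a + 2), fun n hn => ?_⟩
  have hn8 : 8192 ≤ n := le_of_max_le_left hn
  have hna : 10 * a + 2 ≤ n := le_of_max_le_right hn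
  obtain ⟨ℓ, hℓ⟩ := stub_lagrangeIndicator n
  obtain ⟨f₀, hf₀, hfull⟩ := stub_fullSupport n (by omega)
  refine ⟨2 * a * n, fun μ => C (coeff (μ : Fin n →₀ ℕ) f₀) +
      ∑ j : Fin (2 * a * n), X (Sum.inl j) * rename (fun z => Sum.inr (j, z))
        (∏ i : Fin n, Polynomial.aeval (X i : MvPolynomial (Fin n) ℂ) (ℓ ((μ : Fin n →₀ ℕ) i))),
    fun p => ?_, fun D hD0 hDa => ?_⟩
  · choose Λ hΛmem hΛcoeff using fun j : Fin (2 * a * n) =>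
      SeparableCoeffFast.separableCoeff_fast' hn8 (fun i k => (ℓ k).eval (p (Sum.inr (j, i))))
    refine ⟨f₀ + ∑ j : Fin (2 * a * n), C (p (Sum.inl j)) * Λ j,
      GeneratorFour.add_sum_mem_smallCircuits_of_le
        (GeneratorFour.size_budget_sparse hna (by omega)) hf₀ hΛmem _,
      fun μ => ?_⟩
    rw [GeneratorGlue.coeff_add_sum, GeneratorGlue.eval_generator]
    simp only [GeneratorGlue.eval_prod_aeval, hΛcoeff]
  · obtain ⟨m, hm, hmcard⟩ := Sparse.exists_narrow_monomial_shift hfull hD0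
    have hcard : m.support.card ≤ 2 * a * n := GeneratorGlue.card_le_of_two_pow_le hmcard hDa
    obtain ⟨w, hw, hne⟩ := LowSupport.exists_eval_ne_zero_supported hm
    rw [ShiftedSupport.eval_shift] at hne
    exact stub_svHit (degLEMonomials n) (Fin n) (2 * a * n)
      (fun μ => ∏ i : Fin n, Polynomial.aeval (X i : MvPolynomial (Fin n) ℂ) (ℓ ((μ : Fin n →₀ ℕ) i)))
      (fun ν i => (((ν : Fin n →₀ ℕ) i : ℕ) : ℂ)) (GeneratorGlue.eval_indicator hℓ)
      (fun μ => coeff (μ : Fin n →₀ ℕ) f₀) D ⟨m.support, w, hcard, hw, hne⟩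

/-- **Products of sparse polynomials are hit by `SmallCircuits ℂ n 4`** (tree:
`isSuccinctHittingSet_sparseProducts_five`, and `…_sparseProducts` at `10`): for every `a`,
eventually in `n`, the coefficient vectors of `SmallCircuits ℂ n 4` hit every nonzero finite product
`∏_j E_j` of polynomials in the `N = C(2n,n)` coefficient variables with at most `N^a` monomials
each. [cite: ForbesShpilkaVolk2018, Cor. 34] -/
theorem isSuccinctHittingSet_sparseProducts_four :
    ∀ a : ℕ, ∃ n₀ : ℕ, ∀ n : ℕ, n₀ ≤ n →
      IsSuccinctHittingSet (degLEMonomials n) (SmallCircuits ℂ n 4)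
        {D | ∃ (k : ℕ) (E : Fin k → MvPolynomial (degLEMonomials n) ℂ),
          D = ∏ j, E j ∧ ∀ j, (E j).support.card ≤ Nat.choose (2 * n) n ^ a} := by
  intro a
  obtain ⟨n₀, h⟩ := exists_sparseGenerator_four a
  refine ⟨n₀, fun n hn => ?_⟩
  obtain ⟨t, Γ, hreal, hhit⟩ := h n hn
  rintro D ⟨k, E, rfl, hE⟩ hD0
  have hE0 : ∀ j, E j ≠ 0 := fun j h0 => hD0 (Finset.prod_eq_zero (Finset.mem_univ j) h0)
  exact exists_mem_smallCircuits_of_aeval_ne_zero hreal (aeval_generator_ne_zero_of_prod hhit hE0 hE)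

/-- **No product of sparse polynomials is a natural proof against `SmallCircuits ℂ n b`, `b ≥ 4`**
(tree: `not_isNaturalProof_prod_sparse_five`, `… _prod_sparse` at `b ≥ 10`).
[cite: ForbesShpilkaVolk2018, Def. 1 and Cor. 34] -/
theorem not_isNaturalProof_prod_sparse_four (a : ℕ) : ∃ n₀ : ℕ, ∀ n : ℕ, n₀ ≤ n → ∀ b : ℕ, 4 ≤ b →
    ∀ (𝒟 : Set (MvPolynomial (degLEMonomials n) ℂ)) (k : ℕ)
      (E : Fin k → MvPolynomial (degLEMonomials n) ℂ),
      (∀ j, (E j).support.card ≤ Nat.choose (2 * n) n ^ a) →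
        ¬ IsNaturalProof (degLEMonomials n) (SmallCircuits ℂ n b) 𝒟 (∏ j, E j) := by
  obtain ⟨n₀, h⟩ := isSuccinctHittingSet_sparseProducts_four a
  refine ⟨max n₀ 1, fun n hn b hb 𝒟 k E hE hnat => ?_⟩
  have hn₀ : n₀ ≤ n := le_trans (le_max_left _ _) hn
  have hn1 : 1 ≤ n := le_trans (le_max_right _ _) hn
  obtain ⟨f, hf, hne⟩ := h n hn₀ (∏ j, E j) ⟨k, E, rfl, hE⟩ hnat.2.1
  exact hne (hnat.2.2 f (smallCircuits_mono ℂ hb hn1 hf))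

/-- **Level one reduces to the annihilators of the generator, at exponent 4** (tree:
`levelOne_of_generator_annihilators_five`, `max 5 b`; `…_annihilators` at `max 10 b`): for
`n ≥ n₀(1)`, with `Γ` the level-`1` generator of `exists_sparseGenerator_four`, if the level-one
distinguishers ANNIHILATING `Γ` are hit by `SmallCircuits ℂ n b`, then all level-one distinguishers are
hit by `SmallCircuits ℂ n (max 4 b)`. [cite: ForbesShpilkaVolk2018, §3 and Question 6] -/
theorem levelOne_of_generator_annihilators_four :
    ∃ n₀ : ℕ, ∀ n : ℕ, n₀ ≤ n →
      ∃ (t : ℕ) (Γ : degLEMonomials n → MvPolynomial (Fin t ⊕ (Fin t × Fin n)) ℂ),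
        (∀ D : MvPolynomial (degLEMonomials n) ℂ, D ≠ 0 →
          D.support.card ≤ Nat.choose (2 * n) n → aeval Γ D ≠ 0) ∧
        ∀ b : ℕ, IsSuccinctHittingSet (degLEMonomials n) (SmallCircuits ℂ n b)
            (Distinguishers ℂ n 1 ∩ {D | aeval Γ D = 0}) →
          IsSuccinctHittingSet (degLEMonomials n) (SmallCircuits ℂ n (max 4 b))
            (Distinguishers ℂ n 1) := by
  -- adapted from the tree's `levelOne_of_generator_annihilators` (exponent 10)
  obtain ⟨n₀, h⟩ := exists_sparseGenerator_four 1
  refine ⟨max n₀ 1, fun n hn => ?_⟩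
  have hn₀ : n₀ ≤ n := le_trans (le_max_left _ _) hn
  have hn1 : 1 ≤ n := le_trans (le_max_right _ _) hn
  obtain ⟨t, Γ, hreal, hhit⟩ := h n hn₀
  refine ⟨t, Γ, fun D hD0 hD => hhit D hD0 (by simpa only [pow_one] using hD), fun b hres => ?_⟩
  exact isSuccinctHittingSet_of_annihilators hn1 hreal hres

/-! ### Explicit thresholds (appended; consumed by the 8749-side wall `…GeneratorWall`) -/

/-- **Read-once distinguishers are hit by `SmallCircuits ℂ n 4`, explicit threshold**: the statement
of `readOnceHit_four` at every `n ≥ 8192` (same proof; the `∃ n₀` form above does not expose its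
threshold). [cite: ForbesShpilkaVolk2018, §3 and Construction 29] -/
theorem readOnceHit_four_of_le {n : ℕ} (hn : 8192 ≤ n) :
    IsSuccinctHittingSet (degLEMonomials n) (SmallCircuits ℂ n 4)
      {D | ∃ S : Finset (degLEMonomials n), IsPROP S D} := by
  -- verbatim the proof of `readOnceHit_four`
  intro D hD hD0
  obtain ⟨S, hS⟩ := hD
  obtain ⟨ℓ, hℓ⟩ := stub_lagrangeIndicator n
  obtain ⟨f₀, hf₀, -⟩ := stub_fullSupport n (by omega)
  haveI : Fintype (degLEMonomials n) := (GKSS2017.degLEMonomials_finite n).fintype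
  have hcard : Fintype.card (degLEMonomials n) < 2 ^ (2 * 2 * n) := by
    rw [← Nat.card_eq_fintype_card, GKSS2017.card_degLEMonomials]
    calc (2 * n).choose n ≤ 2 ^ (2 * n) := Nat.choose_le_two_pow _ _
      _ < 2 ^ (2 * 2 * n) := Nat.pow_lt_pow_right (by norm_num) (by omega)
  have hgen := stub_readOnceGenerator (degLEMonomials n) (Fin n) (2 * 2 * n)
    (fun μ => ∏ i : Fin n, Polynomial.aeval (X i : MvPolynomial (Fin n) ℂ) (ℓ ((μ : Fin n →₀ ℕ) i)))
    (fun ν i => (((ν : Fin n →₀ ℕ) i : ℕ) : ℂ)) (GeneratorGlue.eval_indicator hℓ) hcard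
    (fun μ => coeff (μ : Fin n →₀ ℕ) f₀) D S hS hD0
  refine Generator.exists_mem_smallCircuits_of_aeval_ne_zero (fun p => ?_) hgen
  choose Λ hΛmem hΛcoeff using fun j : Fin (2 * 2 * n) =>
    SeparableCoeffFast.separableCoeff_fast' (n := n) (by omega)
      (fun i k => (ℓ k).eval (p (Sum.inr (j, i))))
  refine ⟨f₀ + ∑ j : Fin (2 * 2 * n), C (p (Sum.inl j)) * Λ j,
    GeneratorFour.add_sum_mem_smallCircuits_of_le (GeneratorFour.size_budget_readOnce (by omega))
      hf₀ hΛmem _, fun μ => ?_⟩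
  rw [GeneratorGlue.coeff_add_sum, GeneratorGlue.eval_generator]
  simp only [GeneratorGlue.eval_prod_aeval, hΛcoeff]

/-- **The shifted succinct SV generator at exponent 4, explicit threshold**: the statement of
`exists_sparseGenerator_four a` at every `n ≥ max 8192 (10a + 2)` (same proof).
[cite: ForbesShpilkaVolk2018, Construction 29 and Cor. 34] -/
theorem exists_sparseGenerator_four_of_le {a n : ℕ} (hn8 : 8192 ≤ n) (hna : 10 * a + 2 ≤ n) :
    ∃ (t : ℕ) (Γ : degLEMonomials n → MvPolynomial (Fin t ⊕ (Fin t × Fin n)) ℂ),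
      (∀ p : Fin t ⊕ (Fin t × Fin n) → ℂ, ∃ f ∈ SmallCircuits ℂ n 4,
          ∀ μ : degLEMonomials n,
            MvPolynomial.coeff (μ : Fin n →₀ ℕ) f = MvPolynomial.eval p (Γ μ)) ∧
      ∀ D : MvPolynomial (degLEMonomials n) ℂ, D ≠ 0 →
        D.support.card ≤ Nat.choose (2 * n) n ^ a → MvPolynomial.aeval Γ D ≠ 0 := by
  -- verbatim the proof of `exists_sparseGenerator_four`
  obtain ⟨ℓ, hℓ⟩ := stub_lagrangeIndicator n
  obtain ⟨f₀, hf₀, hfull⟩ := stub_fullSupport n (by omega)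
  refine ⟨2 * a * n, fun μ => C (coeff (μ : Fin n →₀ ℕ) f₀) +
      ∑ j : Fin (2 * a * n), X (Sum.inl j) * rename (fun z => Sum.inr (j, z))
        (∏ i : Fin n, Polynomial.aeval (X i : MvPolynomial (Fin n) ℂ) (ℓ ((μ : Fin n →₀ ℕ) i))),
    fun p => ?_, fun D hD0 hDa => ?_⟩
  · choose Λ hΛmem hΛcoeff using fun j : Fin (2 * a * n) =>
      SeparableCoeffFast.separableCoeff_fast' hn8 (fun i k => (ℓ k).eval (p (Sum.inr (j, i))))
    refine ⟨f₀ + ∑ j : Fin (2 * a * n), C (p (Sum.inl j)) * Λ j,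
      GeneratorFour.add_sum_mem_smallCircuits_of_le
        (GeneratorFour.size_budget_sparse hna (by omega)) hf₀ hΛmem _,
      fun μ => ?_⟩
    rw [GeneratorGlue.coeff_add_sum, GeneratorGlue.eval_generator]
    simp only [GeneratorGlue.eval_prod_aeval, hΛcoeff]
  · obtain ⟨m, hm, hmcard⟩ := Sparse.exists_narrow_monomial_shift hfull hD0
    have hcard : m.support.card ≤ 2 * a * n := GeneratorGlue.card_le_of_two_pow_le hmcard hDa
    obtain ⟨w, hw, hne⟩ := LowSupport.exists_eval_ne_zero_supported hm
    rw [ShiftedSupport.eval_shift] at hne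
    exact stub_svHit (degLEMonomials n) (Fin n) (2 * a * n)
      (fun μ => ∏ i : Fin n, Polynomial.aeval (X i : MvPolynomial (Fin n) ℂ) (ℓ ((μ : Fin n →₀ ℕ) i)))
      (fun ν i => (((ν : Fin n →₀ ℕ) i : ℕ) : ℂ)) (GeneratorGlue.eval_indicator hℓ)
      (fun μ => coeff (μ : Fin n →₀ ℕ) f₀) D ⟨m.support, w, hcard, hw, hne⟩

/-- **Products of sparse polynomials are hit by `SmallCircuits ℂ n 4`, explicit threshold**
(`n ≥ max 8192 (10a + 2)`). [cite: ForbesShpilkaVolk2018, Cor. 34] -/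
theorem isSuccinctHittingSet_sparseProducts_four_of_le {a n : ℕ} (hn8 : 8192 ≤ n)
    (hna : 10 * a + 2 ≤ n) :
    IsSuccinctHittingSet (degLEMonomials n) (SmallCircuits ℂ n 4)
      {D | ∃ (k : ℕ) (E : Fin k → MvPolynomial (degLEMonomials n) ℂ),
        D = ∏ j, E j ∧ ∀ j, (E j).support.card ≤ Nat.choose (2 * n) n ^ a} := by
  obtain ⟨t, Γ, hreal, hhit⟩ := exists_sparseGenerator_four_of_le (a := a) hn8 hna
  rintro D ⟨k, E, rfl, hE⟩ hD0
  have hE0 : ∀ j, E j ≠ 0 := fun j h0 => hD0 (Finset.prod_eq_zero (Finset.mem_univ j) h0)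
  exact exists_mem_smallCircuits_of_aeval_ne_zero hreal (aeval_generator_ne_zero_of_prod hhit hE0 hE)

end Summit.ValiantsHypothesis.ValiantsHypothesis.Theorems.BarrierLever.SuccinctHittingSetsForVP

end
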